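import Literature.NumberTheory.Automorphic.GLnLeviOrbitalDescent
import HarnessLib

/-!
# `GL_n(𝒪)` against the Levi decomposition `P_c = M_c U_c`: `m u ∈ GL_n(𝒪) ↔ m, u ∈ GL_n(𝒪)`, the constant term of `1_K`,
# and `‖det K_p‖ = 1` on `P_c ∩ GL_n(𝒪)`
(Rogawski (1990), §4.13, proof of Lemma 4.13.1 p. 70 («`f̄^P(m) = δ_P(m)^{1/2} ∫_K ∫_N f(k⁻¹ m n k)`» at the unit `f = 1_K` of the
Hecke algebra); §4.9 Prop. 4.9.1 (b) p. 55; Cartier, *Representations of p-adic groups* (Corvallis 1979), §IV)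

Topic `NumberTheory/Automorphic`; namespace `Literature.NumberTheory.Automorphic`. THEOREMS ONLY (no definition, no instance, no named
fact, no `sorry`); generic: `F` a field with a valuative relation (§1 algebra) resp. a non-archimedean local field (§1 measure, §2),
`c : Fin n → α` a block labelling (§1) resp. a two-block labelling `c : Fin n → Bool` (§2). Cell `pub/hodgecm-mathlib`, programme
P3a, letter N7 (#103) pay-down at the split places (LEAD F0P3a-plan T6-111∕«D-N7s», generic half): the three `GL_n`-facts the unit
fundamental lemma at a split place consumes on top of ★ `GLnLeviOrbitalDescent` («D-S1c»).

* `mem_glInt_and_mem_glInt_of_levi_mul_unipotent`, `levi_mul_unipotent_mem_glInt_iff` — for `m ∈ M_c`, `u ∈ U_c`: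
  `m u ∈ GL_n(𝒪) ↔ m ∈ GL_n(𝒪) ∧ u ∈ GL_n(𝒪)` (the diagonal blocks of `m u` are those of `m`: ★ `leviProjection` is a homomorphism
  killing `U_c`; block-diagonal matrices with integral blocks and integral inverse blocks are in `GL_n(𝒪)`);
* **`lintegral_prod_indicator_glInt_conj_levi_mul`** — «THE CONSTANT TERM OF `1_K` IS `vol · 1_{K_M}`»: for `m ∈ M_c`,
  `∫⁻_{K × U_c} 1_K(k (m u) k⁻¹) d(κ ⊗ μ_U) = κ(K) · μ_U(U_c ∩ K) · 1_K(m)` — the inner double integral of ★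
  `exists_lintegral_descConj_eq_mul_lintegral_levi` at `F = 1_K`;
* **`normAbs_det_boxAd_eq_one_of_mem_glInt`** — for `p ∈ P_c ∩ GL_n(𝒪)` the box matrix `K_p = (p_{ii′}(p⁻¹)_{j′j})` of `Ad(p)` on
  `𝔲_c ≅ F^{I×J}` (the matrix of ★ `GLnBlockScalarOrbitalIntegral`∕`GLnLeviOrbitalDescent`) is the Kronecker product of the Levi block `p_I`
  with `((p⁻¹)_J)ᵀ`, so `‖det K_p‖_F = 1` (`δ_P ≡ 1` on `P_c ∩ K`): on the support of `1_{K_M}` the factor `‖det K_p‖` of the descent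
  disappears and `|D_{G∕M}(p)|^{1∕2} = ‖det(1 − K_p)‖`.

## References
* J. D. Rogawski, *Automorphic Representations of Unitary Groups in Three Variables* (1990), §4.13 proof of Lemma 4.13.1 p. 70; §4.9
  Prop. 4.9.1 (b) p. 55 [Rogawski1990].
* P. Cartier, *Representations of 𝔭-adic groups: a survey*, Corvallis 1979, §IV [Corvallis1979].
-/

set_option autoImplicit false

noncomputable section

open MeasureTheory Measure Set Filter Topology Literature.MeasureTheory.Group
open scoped ENNReal NNReal Matrix MatrixGroups

namespace Literature.NumberTheory.Automorphic

open Literature.NumberTheory.GaloisRepresentations.IsNonarchimedeanLocalField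

/-! ## §1 `m u ∈ GL_n(𝒪) ↔ m, u ∈ GL_n(𝒪)`; the constant term of `1_K` -/

section Levi

variable {F : Type*} [Field F] [ValuativeRel F] {n : ℕ} {α : Type*} [LinearOrder α] [Fintype α]
  {c : Fin n → α}

/-- **`m u ∈ GL_n(𝒪) ⇒ m ∈ GL_n(𝒪)` and `u ∈ GL_n(𝒪)`** for `m` in the standard Levi subgroup `M_c` and `u` in the unipotent radical
`U_c`: the diagonal blocks of `m u` are those of `m` (★ `leviProjection` is a homomorphism killing `U_c`), so the blocks of `m` and of
`m⁻¹` are integral, hence the block-diagonal `m` is in `GL_n(𝒪)`, and then `u = m⁻¹ (m u)` is. This is the set-theoretic content of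
«the constant term of `1_K` along `P_c` is `1_{K ∩ M_c}`» (Rogawski 1990, proof of Lemma 4.13.1 p. 70; Cartier, Corvallis §IV).
[cite: Rogawski1990, §4.13, proof of Lemma 4.13.1, p. 70] -/
theorem mem_glInt_and_mem_glInt_of_levi_mul_unipotent {m u : GL (Fin n) F} (hm : m ∈ standardLeviGL F c)
    (hu : u ∈ unipotentRadicalGL F c) (h : m * u ∈ glInt n F) : m ∈ glInt n F ∧ u ∈ glInt n F := by
  classical
  obtain ⟨t, rfl⟩ := hm
  obtain ⟨p, hp, rfl⟩ := hu
  set q : standardParabolicGL F c := leviEmbeddingP F c t * p with hq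
  have hqcoe : (q : GL (Fin n) F) = leviEmbedding F c t * (standardParabolicGL F c).subtype p := rfl
  have hqt : leviProjection F c q = t := by
    rw [hq, map_mul, leviProjection_leviEmbeddingP_apply, (MonoidHom.mem_ker).1 hp, mul_one]
  rw [← hqcoe] at h
  obtain ⟨hint, hinv⟩ := (mem_glInt_iff _).1 h
  have ht : ∀ (a : α) (i j : {i // c i = a}),
      ((t a : GL {i // c i = a} F) : Matrix {i // c i = a} {i // c i = a} F) i j ∈ (ValuativeRel.valuation F).integer :=
      fun a i j => by
    rw [← hqt, leviProjection_apply_coe]; exact hint _ _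
  have hti : ∀ (a : α) (i j : {i // c i = a}),
      (((t a)⁻¹ : GL {i // c i = a} F) : Matrix {i // c i = a} {i // c i = a} F) i j ∈ (ValuativeRel.valuation F).integer :=
      fun a i j => by
    rw [← hqt, ← Pi.inv_apply, ← map_inv, leviProjection_apply_coe, Subgroup.coe_inv]; exact hinv _ _
  have hm' : leviEmbedding F c t ∈ glInt n F := by
    rw [mem_glInt_iff]
    refine ⟨fun i j => ?_, fun i j => ?_⟩
    · rw [leviEmbedding_apply, blockDiagonalGL_apply_coe_dite]
      by_cases hij : c i = c j
      · rw [dif_pos hij]; exact ht _ _ _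
      · rw [dif_neg hij]; exact zero_mem _
    · rw [leviEmbedding_apply, ← map_inv, blockDiagonalGL_apply_coe_dite]
      by_cases hij : c i = c j
      · rw [dif_pos hij, Pi.inv_apply]; exact hti _ _ _
      · rw [dif_neg hij]; exact zero_mem _
  refine ⟨hm', ?_⟩
  have hu' : (standardParabolicGL F c).subtype p =
      (leviEmbedding F c t)⁻¹ * (leviEmbedding F c t * (standardParabolicGL F c).subtype p) := by
    rw [inv_mul_cancel_left]
  rw [hu', ← hqcoe]
  exact mul_mem (inv_mem hm') h

/-- **`m u ∈ GL_n(𝒪) ↔ m ∈ GL_n(𝒪) ∧ u ∈ GL_n(𝒪)`** (`m ∈ M_c`, `u ∈ U_c`). [cite: Rogawski1990, §4.13, proof of Lemma 4.13.1, p. 70] -/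
theorem levi_mul_unipotent_mem_glInt_iff {m u : GL (Fin n) F} (hm : m ∈ standardLeviGL F c)
    (hu : u ∈ unipotentRadicalGL F c) : m * u ∈ glInt n F ↔ m ∈ glInt n F ∧ u ∈ glInt n F :=
  ⟨mem_glInt_and_mem_glInt_of_levi_mul_unipotent hm hu, fun h => mul_mem h.1 h.2⟩

variable [TopologicalSpace F] [IsNonarchimedeanLocalField F] [MeasurableSpace (GL (Fin n) F)] [BorelSpace (GL (Fin n) F)]

/-- **The constant term of `1_K` is `vol · 1_{K_M}`**: for `m ∈ M_c` and Haar-type measures `κ` on `K = GL_n(𝒪)`, `μ_U` on `U_c`,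
`∫⁻_{K × U_c} 1_K(k (m u) k⁻¹) d(κ ⊗ μ_U) = κ(K) · μ_U(U_c(𝒪)) · 1_K(m)` — the inner double integral of ★
`exists_lintegral_descConj_eq_mul_lintegral_levi` at the unit of the Hecke algebra (Rogawski 1990, Prop. 4.9.1 (b): «`f` and `f^H` are the
units of the Hecke algebras»). [cite: Rogawski1990, §4.13, proof of Lemma 4.13.1, p. 70] [cite: Rogawski1990, §4.9 Prop. 4.9.1 (b) p. 55] -/
theorem lintegral_prod_indicator_glInt_conj_levi_mul (κ : Measure ↥(glInt n F))
    (μU : Measure ↥(unipotentRadicalGL F c)) [SFinite μU] {m : GL (Fin n) F} (hm : m ∈ standardLeviGL F c) :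
    ∫⁻ q : ↥(glInt n F) × ↥(unipotentRadicalGL F c),
        (glInt n F : Set (GL (Fin n) F)).indicator 1 ((q.1 : GL (Fin n) F) * (m * (q.2 : GL (Fin n) F)) * (q.1 : GL (Fin n) F)⁻¹)
          ∂(κ.prod μU) =
      κ univ * μU {u | (u : GL (Fin n) F) ∈ glInt n F} * (glInt n F : Set (GL (Fin n) F)).indicator 1 m := by
  classical
  haveI : BorelSpace ↥(unipotentRadicalGL F c) := Subtype.borelSpace _
  -- conjugation by `k ∈ K` does not change membership in `K`
  have h1 : ∀ q : ↥(glInt n F) × ↥(unipotentRadicalGL F c),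
      (glInt n F : Set (GL (Fin n) F)).indicator (1 : GL (Fin n) F → ℝ≥0∞)
          ((q.1 : GL (Fin n) F) * (m * (q.2 : GL (Fin n) F)) * (q.1 : GL (Fin n) F)⁻¹) =
        {u : ↥(unipotentRadicalGL F c) | m * (u : GL (Fin n) F) ∈ glInt n F}.indicator 1 q.2 := fun q => by
    have hiff : (q.1 : GL (Fin n) F) * (m * (q.2 : GL (Fin n) F)) * (q.1 : GL (Fin n) F)⁻¹ ∈ glInt n F ↔
        m * (q.2 : GL (Fin n) F) ∈ glInt n F :=
      (Subgroup.mul_mem_cancel_right _ (inv_mem q.1.2)).trans (Subgroup.mul_mem_cancel_left _ q.1.2)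
    by_cases hq : m * (q.2 : GL (Fin n) F) ∈ glInt n F
    · rw [Set.indicator_of_mem (hiff.2 hq), Set.indicator_of_mem
        (s := {u : ↥(unipotentRadicalGL F c) | m * (u : GL (Fin n) F) ∈ glInt n F}) hq]
      rfl
    · rw [Set.indicator_of_notMem (fun h => hq (hiff.1 h)), Set.indicator_of_notMem
        (s := {u : ↥(unipotentRadicalGL F c) | m * (u : GL (Fin n) F) ∈ glInt n F}) hq]
  have hS : MeasurableSet {u : ↥(unipotentRadicalGL F c) | m * (u : GL (Fin n) F) ∈ glInt n F} :=
    ((isOpen_glInt n F).preimage (continuous_const.mul continuous_subtype_val)).measurableSet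
  simp_rw [h1]
  rw [lintegral_prod (fun q : ↥(glInt n F) × ↥(unipotentRadicalGL F c) =>
      ({u : ↥(unipotentRadicalGL F c) | m * (u : GL (Fin n) F) ∈ glInt n F}).indicator 1 q.2)
    (((measurable_const.indicator hS).comp measurable_snd).aemeasurable)]
  simp only [lintegral_indicator_one hS, lintegral_const]
  -- `{u | m u ∈ K}` is `U_c(𝒪)` if `m ∈ K`, and empty otherwise
  by_cases hmK : m ∈ glInt n F
  · have hS' : {u : ↥(unipotentRadicalGL F c) | m * (u : GL (Fin n) F) ∈ glInt n F} =
        {u : ↥(unipotentRadicalGL F c) | (u : GL (Fin n) F) ∈ glInt n F} := Set.ext fun u => by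
      rw [mem_setOf_eq, mem_setOf_eq, Subgroup.mul_mem_cancel_left _ hmK]
    rw [hS', Set.indicator_of_mem (show m ∈ (glInt n F : Set (GL (Fin n) F)) from hmK), Pi.one_apply, mul_one, mul_comm]
  · have hS' : {u : ↥(unipotentRadicalGL F c) | m * (u : GL (Fin n) F) ∈ glInt n F} = ∅ :=
      Set.eq_empty_of_forall_notMem fun u hu => hmK (mem_glInt_and_mem_glInt_of_levi_mul_unipotent hm u.2 hu).1
    rw [hS', Set.indicator_of_notMem (show m ∉ (glInt n F : Set (GL (Fin n) F)) from hmK), measure_empty, mul_zero,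
      zero_mul]

end Levi

/-! ## §2 `‖det K_p‖ = 1` on `P_c ∩ GL_n(𝒪)` -/

section Box

variable {F : Type*} [Field F] [ValuativeRel F] [TopologicalSpace F] [IsNonarchimedeanLocalField F] {n : ℕ}
  {c : Fin n → Bool}

omit [TopologicalSpace F] [IsNonarchimedeanLocalField F] in
/-- The determinant of a matrix with integral entries is integral (`det` commutes with the inclusion `𝒪 → F`). [folklore] -/
private theorem det_mem_integer {ι : Type*} [Fintype ι] [DecidableEq ι] (M : Matrix ι ι F)
    (h : ∀ i j, M i j ∈ (ValuativeRel.valuation F).integer) : M.det ∈ (ValuativeRel.valuation F).integer := by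
  let M₀ : Matrix ι ι (ValuativeRel.valuation F).integer := fun i j => ⟨M i j, h i j⟩
  have hM : M = (ValuativeRel.valuation F).integer.subtype.mapMatrix M₀ := by
    ext i j; rfl
  rw [hM, ← RingHom.map_det]
  exact SetLike.coe_mem _

/-- **`‖det K_p‖ = 1` on `P_c ∩ GL_n(𝒪)`**: for `p ∈ P_c ∩ K` the box matrix `K_p = (p_{ii′} (p⁻¹)_{j′j})` of `Ad(p)` on
`𝔲_c ≅ F^{I × J}` is the Kronecker product of the Levi block `p_I` with the transpose of the block `(p⁻¹)_J`; both blocks and their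
inverses are integral, so their determinants are units and `δ_P(p) = ‖det K_p‖_F = 1` — the factor `‖det K_p‖` of ★
`exists_lintegral_descConj_eq_mul_lintegral_levi` disappears on the support of `1_{K_M}`. [cite: Rogawski1990, §4.13, proof of Lemma 4.13.1, p. 70] -/
theorem normAbs_det_boxAd_eq_one_of_mem_glInt (p : standardParabolicGL F c) (hp : (p : GL (Fin n) F) ∈ glInt n F) :
    normAbs F (Matrix.of fun q q' : {i : Fin n // c i = false} × {j : Fin n // c j = true} =>
        ((p : GL (Fin n) F) : Matrix (Fin n) (Fin n) F) q.1 q'.1 *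
          (((p⁻¹ : standardParabolicGL F c) : GL (Fin n) F) : Matrix (Fin n) (Fin n) F) q'.2 q.2).det = 1 := by
  -- the box is a Kronecker product of the two Levi blocks
  have hbox : (Matrix.of fun q q' : {i : Fin n // c i = false} × {j : Fin n // c j = true} =>
        ((p : GL (Fin n) F) : Matrix (Fin n) (Fin n) F) q.1 q'.1 *
          (((p⁻¹ : standardParabolicGL F c) : GL (Fin n) F) : Matrix (Fin n) (Fin n) F) q'.2 q.2) =
      Matrix.kroneckerMap (· * ·)
        ((leviProjection F c p false : GL {i : Fin n // c i = false} F) : Matrix {i : Fin n // c i = false} {i : Fin n // c i = false} F)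
        ((leviProjection F c p⁻¹ true : GL {j : Fin n // c j = true} F) : Matrix {j : Fin n // c j = true} {j : Fin n // c j = true} F)ᵀ := by
    ext q q'
    rw [Matrix.of_apply, Matrix.kroneckerMap_apply, Matrix.transpose_apply, leviProjection_apply_coe,
      leviProjection_apply_coe]
  -- unit determinants of the blocks of an integral `r ∈ P_c`
  have hval : ∀ (a : Bool) (r : standardParabolicGL F c), (r : GL (Fin n) F) ∈ glInt n F →
      normAbs F ((leviProjection F c r a : GL {i : Fin n // c i = a} F) : Matrix {i : Fin n // c i = a} {i : Fin n // c i = a} F).det = 1 := fun a r hr => by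
    obtain ⟨hint, hinv⟩ := (mem_glInt_iff _).1 hr
    have hA : ((leviProjection F c r a : GL {i : Fin n // c i = a} F) : Matrix {i : Fin n // c i = a} {i : Fin n // c i = a} F).det ∈ (ValuativeRel.valuation F).integer :=
      det_mem_integer _ fun i j => by rw [leviProjection_apply_coe]; exact hint _ _
    have hB : (((leviProjection F c r a)⁻¹ : GL {i : Fin n // c i = a} F) : Matrix {i : Fin n // c i = a} {i : Fin n // c i = a} F).det ∈
        (ValuativeRel.valuation F).integer :=
      det_mem_integer _ fun i j => by
        rw [← Pi.inv_apply, ← map_inv, leviProjection_apply_coe, Subgroup.coe_inv]; exact hinv _ _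
    have h1 : normAbs F ((leviProjection F c r a : GL {i : Fin n // c i = a} F) : Matrix {i : Fin n // c i = a} {i : Fin n // c i = a} F).det ≤ 1 :=
      normAbs_le_one_iff.2 hA
    have h2 : normAbs F (((leviProjection F c r a)⁻¹ : GL {i : Fin n // c i = a} F) : Matrix {i : Fin n // c i = a} {i : Fin n // c i = a} F).det ≤ 1 :=
      normAbs_le_one_iff.2 hB
    have hprod : normAbs F ((leviProjection F c r a : GL {i : Fin n // c i = a} F) : Matrix {i : Fin n // c i = a} {i : Fin n // c i = a} F).det *
        normAbs F (((leviProjection F c r a)⁻¹ : GL {i : Fin n // c i = a} F) : Matrix {i : Fin n // c i = a} {i : Fin n // c i = a} F).det = 1 := by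
      rw [← map_mul, ← Matrix.det_mul, ← Units.val_mul, mul_inv_cancel, Units.val_one, Matrix.det_one, map_one]
    refine le_antisymm h1 ?_
    calc (1 : ℝ≥0) = _ := hprod.symm
      _ ≤ normAbs F ((leviProjection F c r a : GL {i : Fin n // c i = a} F) : Matrix {i : Fin n // c i = a} {i : Fin n // c i = a} F).det * 1 := by gcongr
      _ = _ := mul_one _
  rw [hbox, Matrix.det_kronecker, Matrix.det_transpose, map_mul, map_pow, map_pow, hval false p hp,
    hval true p⁻¹ (by rw [Subgroup.coe_inv]; exact inv_mem hp), one_pow, one_pow, mul_one]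

end Box

end Literature.NumberTheory.Automorphic

end
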